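import Summits.KontsevichZagierPeriods.KontsevichZagierPeriods.Theorems.LinRedNormalFormArrangementNormalFormStubRebaseSimpleZeroNestedDiffE1Ends

/-!
# Stub `stub_rebaseSimpleZeroTwo`, part `rebaseSimpleZero_HDiff1_of_HPar1` (crux
`ArrangementNormalForm`, line `janus-bands`) — brick `NestedDiffE1Mirror`

**The base reflection `y ↦ −y`** (rule 2) of a datum of the interval normal form `HDiff₁`
(`RebaseE1.IsDN`): the clean nest `A(y) < tᵢ < tⱼ < B(y)` over `{l < y < u}` with the literal
integrand `K/((y − r)(tᵢ − cᵢ)(tⱼ − cⱼ(y)))` becomes the clean nest `Ã(y) < tᵢ < tⱼ < B̃(y)` over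
`{−u < y < −l}` with slope-negated bounds and letters (`RebaseE1.negS`), base pole `−r` and the
numerator `−p` (`RebaseE1.IsDN.mirror`; the map is the rank-one rational affine map
`RebaseDiff.rkMap` with Jacobian `−1`). The reflected datum is again a datum of `HDiff₁`
(`RebaseE1.mirT`, `RebaseE1.mirA`, `RebaseE1.LData.mirror`) and its RIGHT end is the left end of
the original, so that the singular-end analysis need only be done at the left end.
Registered: `rebaseSimpleZero_E1mirror`.

References: M. Kontsevich, D. Zagier, *Periods* (2001), §1.2, rule (2).
-/

noncomputable section

open Set MeasureTheory MvPolynomial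
open Literature.NumberTheory.Transcendental Literature.ModelTheory.ExponentialFields

namespace Summit.KontsevichZagierPeriods.ArrangementNormalForm.JanusBands

namespace RebaseE1

open SeparatePos RebasePos RebaseZero RebaseNest RebaseDiff

variable {i j : Fin 2} {s : KZ.IntegralRep (0 + 1 + 2)} {l u : ℚ} {A B : Cf} {T : BData}
  {p : MvPolynomial (Fin 0) ℚ} {a : Fin 2 → Option Cf} {ci cj : Cf}

/-! ### Reflected data -/

/-- The slope-negated atom: `negS c (y) = c(−y)`. -/
def negS (c : Cf) : Cf := RebaseZero.mk (-c.1 (Fin.last 0)) c.2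

/-- Values of the slope-negated atom. -/
theorem ev_negS (c : Cf) (y : ℝ) : ev (negS c) y = ev c (-y) := by
  rw [negS, ev_mk, ev]; push_cast; ring

/-- Slope of the slope-negated atom. -/
@[simp] theorem negS_fst (c : Cf) : (negS c).1 (Fin.last 0) = -c.1 (Fin.last 0) := rfl

/-- Constant of the slope-negated atom. -/
@[simp] theorem negS_snd (c : Cf) : (negS c).2 = c.2 := rfl

/-- Rational values of the slope-negated atom. -/
theorem evq_negS (c : Cf) (q : ℚ) : evq (negS c) (-q) = evq c q := by
  rw [evq, evq, negS_fst, negS_snd]; ring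

/-- The reflected base-factor data: the base pole `r` becomes `−r`. -/
def mirT (T : BData) : BData := ⟨T.m, T.L, T.e, T.ℓ₁, (T.ℓ₂.1, -T.ℓ₂.2), T.n₁, T.n₂⟩

/-- The reflected pole. -/
@[simp] theorem mirT_ℓ₂ (T : BData) : (mirT T).ℓ₂.2 = -T.ℓ₂.2 := rfl

/-- The reflected letters. -/
def mirA (a : Fin 2 → Option Cf) : Fin 2 → Option Cf := fun l => (a l).map negS

/-- The letter data are preserved by the reflection. -/
theorem LData.mirror (hL : LData T a i j ci cj) : LData (mirT T) (mirA a) i j (negS ci) (negS cj) :=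
  ⟨hL.ne, by simp only [mirA, hL.hi, Option.map_some], by simp only [mirA, hL.hj, Option.map_some],
    by rw [negS_fst, hL.ci0, neg_zero], by rw [negS_fst, neg_ne_zero]; exact hL.cj0, hL.n1, hL.n2⟩

/-! ### The reflection map -/

/-- Coefficients of the rank-one functional of the base reflection: `−2 y`. -/
def mirCoef : Fin (0 + 1 + 2) → ℚ := Function.update 0 (yIdx 2) (-2)

/-- The functional of the base reflection. -/
theorem rkSum_mir (hij : i ≠ j) (w : Fin (0 + 1 + 2) → ℝ) : ∑ l, (mirCoef l : ℝ) * w l = -2 * yv w := by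
  rw [sum_coord hij]
  simp only [mirCoef, Function.update_self, Function.update_of_ne (yIdx_ne_tIdx i).symm,
    Function.update_of_ne (yIdx_ne_tIdx j).symm, Pi.zero_apply, Rat.cast_zero, zero_mul, add_zero,
    Rat.cast_neg, Rat.cast_ofNat, yv]

/-- The Jacobian number of the base reflection is `−1`. -/
theorem rkJac_mir : rkJac mirCoef xA = -1 := by
  have h : ∑ l, mirCoef l * xA l = mirCoef (yIdx 2) := by
    simp only [xA, Pi.single_apply, mul_ite, mul_one, mul_zero, Finset.sum_ite_eq', Finset.mem_univ,
      if_true]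
  rw [rkJac, h, mirCoef, Function.update_self]
  norm_num

/-- The base reflection on the base. -/
theorem yv_mir (hij : i ≠ j) (w : Fin (0 + 1 + 2) → ℝ) : yv (rkMap mirCoef xA 0 w) = -yv w := by
  show rkMap mirCoef xA 0 w (yIdx 2) = _
  rw [rkMap_apply, rkSum_mir hij]
  simp only [xA, Pi.single_eq_same, Rat.cast_one, mul_one, Rat.cast_zero, add_zero]
  show yv w + _ = _
  ring

/-- The base reflection fixes the fibres. -/
theorem tv_mir (w : Fin (0 + 1 + 2) → ℝ) (l : Fin 2) : tv (rkMap mirCoef xA 0 w) l = tv w l := by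
  show rkMap mirCoef xA 0 w (tIdx l) = _
  rw [rkMap_apply]
  simp only [xA, Pi.single_eq_of_ne (yIdx_ne_tIdx l).symm, Rat.cast_zero, mul_zero, add_zero]
  rfl

/-- The inverse base reflection on the base. -/
theorem yv_mirInv (hij : i ≠ j) (z : Fin (0 + 1 + 2) → ℝ) : yv (rkInv mirCoef xA 0 z) = -yv z := by
  show rkInv mirCoef xA 0 z (yIdx 2) = _
  rw [rkInv_apply, rkSum_mir hij, rkJac_mir]
  simp only [xA, Pi.single_eq_same, Rat.cast_one, mul_one, Rat.cast_zero, add_zero, Rat.cast_neg]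
  show yv z - _ = _
  ring

/-- The inverse base reflection fixes the fibres. -/
theorem tv_mirInv (z : Fin (0 + 1 + 2) → ℝ) (l : Fin 2) : tv (rkInv mirCoef xA 0 z) l = tv z l := by
  show rkInv mirCoef xA 0 z (tIdx l) = _
  rw [rkInv_apply]
  simp only [xA, Pi.single_eq_of_ne (yIdx_ne_tIdx l).symm, Rat.cast_zero, mul_zero, sub_zero]
  rfl

/-! ### The reflected datum -/

/-- The reflected integrand is the pull-back of the integrand (Jacobian `|−1| = 1`). -/
theorem glitB_mirror (hL : LData T a i j ci cj) (w : Fin (0 + 1 + 2) → ℝ) :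
    glitB (mirT T) (MvPolynomial.C (-1) * p) (mirA a) w =
      glitB T p a (rkMap mirCoef xA 0 w) * |((rkJac mirCoef xA : ℚ) : ℝ)| := by
  have hij := hL.ne
  have hLm := hL.mirror
  rw [rkJac_mir, Rat.cast_neg, Rat.cast_one, abs_neg, abs_one, mul_one, glit_C_mul,
    glitB_two (mirT T) p (mirA a) hij (negS ci) (negS cj) hLm.hi hLm.hj hLm.n1 hLm.n2,
    glitB_two T p a hij ci cj hL.hi hL.hj hL.n1 hL.n2, yv_mir hij, tv_mir, tv_mir, ev_negS, ev_negS, mirT_ℓ₂]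
  have hK : Kc (mirT T) p = Kc T p := rfl
  have e : (1 : ℝ) / (-yv w - (T.ℓ₂.2 : ℝ)) = -(1 / (yv w - ((-T.ℓ₂.2 : ℚ) : ℝ))) := by
    rw [Rat.cast_neg, sub_neg_eq_add, ← neg_add', one_div_neg_eq_neg_one_div]
  rw [hK, e]
  push_cast
  ring

/-- **The base reflection of a datum of `HDiff₁`** (rule 2): a datum over `{l < y < u}` is
congruent modulo `KZ.relations` to a datum over `{−u < y < −l}` with slope-negated bounds and
letters, base pole `−r` and numerator `−p`. [Kontsevich–Zagier 2001, §1.2, rule (2)] -/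
theorem IsDN.mirror (h : IsDN s l u A B T p a i j) (hL : LData T a i j ci cj) :
    ∃ s' : KZ.IntegralRep (0 + 1 + 2), IsDN s' (-u) (-l) (negS A) (negS B) (mirT T) (MvPolynomial.C (-1) * p) (mirA a) i j ∧
      KZ.of s - KZ.of s' ∈ KZ.relations := by
  have hij := h.ne
  set R := gDom 0 2 2 ![RebaseZero.mk 1 (-(-u)), RebaseZero.mk (-1) (-l)] (nlo i (negS A)) (nhi j (negS B)) with hR
  have mR : ∀ w, w ∈ R ↔ ((((-u : ℚ) : ℝ) < yv w ∧ yv w < ((-l : ℚ) : ℝ)) ∧ ev (negS A) (yv w) < tv w i ∧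
      tv w i < tv w j ∧ tv w j < ev (negS B) (yv w)) := fun w => by rw [hR, mem_nDom_Ioo hij]
  have hRD : ∀ w ∈ R, rkMap mirCoef xA 0 w ∈ s.domain := fun w hw => by
    obtain ⟨⟨h1, h2⟩, h3, h4, h5⟩ := (mR w).1 hw
    rw [ev_negS] at h3 h5
    push_cast at h1 h2
    rw [h.mem, yv_mir hij, tv_mir, tv_mir]
    exact ⟨⟨by linarith, by linarith⟩, h3, h4, h5⟩
  have hDR : ∀ z ∈ s.domain, rkInv mirCoef xA 0 z ∈ R := fun z hz => by
    obtain ⟨⟨h1, h2⟩, h3, h4, h5⟩ := (h.mem z).1 hz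
    rw [mR, yv_mirInv hij, tv_mirInv, tv_mirInv, ev_negS, ev_negS, neg_neg]
    push_cast
    exact ⟨⟨by linarith, by linarith⟩, h3, h4, h5⟩
  have hJ : rkJac mirCoef xA ≠ 0 := by rw [rkJac_mir]; norm_num
  obtain ⟨s', hd', hi', hbd', hrel⟩ := rankOne_cov s mirCoef xA 0 hJ (isSemialgebraic_gDom _ _ _ _) hRD hDR
    (glitB (mirT T) (MvPolynomial.C (-1) * p) (mirA a))
    (isSemialgebraicFunOn_glit (isSemialgebraic_gDom _ _ _ _) _ _ _ _ _ _ _ _)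
    (fun w hw => by rw [glitB_mirror hL w, h.int (hRD w hw)])
  refine ⟨s', ⟨hij, hd', fun w _ => by rw [hi'], hbd' h.bdd, by linarith [h.lu], fun y h1 h2 => ?_, ?_⟩, hrel⟩
  · rw [ev_negS, ev_negS]
    push_cast at h1 h2
    exact h.AB (-y) (by linarith) (by linarith)
  · rw [mirT_ℓ₂]
    rcases h.pole with hp | hp
    · exact Or.inr (by linarith)
    · exact Or.inl (by linarith)

/-- **Goodness is reflected.** A datum of `HDiff₁` is good as soon as its base reflection is.
[Kontsevich–Zagier 2001, §1.2, rule (2)] -/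
theorem IsDN.good_of_mirror (h : IsDN s l u A B T p a i j) (hL : LData T a i j ci cj)
    (hm : ∀ s' : KZ.IntegralRep (0 + 1 + 2),
      IsDN s' (-u) (-l) (negS A) (negS B) (mirT T) (MvPolynomial.C (-1) * p) (mirA a) i j → Good 2 (KZ.of s')) :
    Good 2 (KZ.of s) := by
  obtain ⟨s', h', hrel⟩ := h.mirror hL
  exact RebaseZero.good_of_sub_mem hrel (hm s' h')

/-! ### Bookkeeping of the reflected ends -/

/-- The base constant of the reflected datum is the negated one. -/
theorem Kc_mirror (T : BData) (p : MvPolynomial (Fin 0) ℚ) :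
    Kc (mirT T) (MvPolynomial.C (-1) * p) = -Kc T p := by
  have h1 : Kc (mirT T) (MvPolynomial.C (-1) * p) = Kc T (MvPolynomial.C (-1) * p) := rfl
  rw [h1, Kc, Kc, MvPolynomial.coeff_C_mul]
  push_cast
  ring

/-- The base constant of the reflected datum vanishes iff the original one does. -/
theorem Kc_mirror_ne (hK : Kc T p ≠ 0) : Kc (mirT T) (MvPolynomial.C (-1) * p) ≠ 0 := by
  rw [Kc_mirror]; exact neg_ne_zero.2 hK

/-- The right end of the original is the left end of the reflection: pinches. -/
theorem pinch_mirror : evq (negS A) (-u) = evq (negS B) (-u) ↔ evq A u = evq B u := by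
  rw [evq_negS, evq_negS]

/-- The right end of the original is the left end of the reflection: strict non-pinches. -/
theorem lt_mirror (q : ℚ) : evq (negS A) (-q) < evq (negS B) (-q) ↔ evq A q < evq B q := by
  rw [evq_negS, evq_negS]

end RebaseE1

/-- **Registered brick `rebaseSimpleZero_E1mirror`** (part `rebaseSimpleZero_HDiff1_of_HPar1` of
`stub_rebaseSimpleZeroTwo`, line `janus-bands`): the base reflection `y ↦ −y` (rule 2, the
rank-one rational affine map of Jacobian `−1`) turns a datum of the interval normal form `HDiff₁`
over `{l < y < u}` into a datum of `HDiff₁` over `{−u < y < −l}` with slope-negated bounds and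
letters, base pole `−r` and numerator `−p`, congruent to it modulo `KZ.relations`
(`RebaseE1.IsDN.mirror`). [Kontsevich–Zagier 2001, §1.2, rule (2)] -/
theorem rebaseSimpleZero_E1mirror (i j : Fin 2) (s : KZ.IntegralRep (0 + 1 + 2)) (l u : ℚ) (A B ci cj : (Fin (0 + 1) → ℚ) × ℚ) (T : RebaseZero.BData) (p : MvPolynomial (Fin 0) ℚ) (a : Fin 2 → Option ((Fin (0 + 1) → ℚ) × ℚ)) (h : RebaseE1.IsDN s l u A B T p a i j) (hL : RebaseE1.LData T a i j ci cj) : ∃ s' : KZ.IntegralRep (0 + 1 + 2), RebaseE1.IsDN s' (-u) (-l) (RebaseE1.negS A) (RebaseE1.negS B) (RebaseE1.mirT T) (MvPolynomial.C (-1) * p) (RebaseE1.mirA a) i j ∧ KZ.of s - KZ.of s' ∈ KZ.relations :=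
  h.mirror hL

end Summit.KontsevichZagierPeriods.ArrangementNormalForm.JanusBands
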